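import Summits.ResolutionOfSingularities.ResolutionOfSingularities.Theorems.FrobeniusLadderFInjectiveMacaulayficationFullLastCentreAxisOrder
import HarnessLib

/-!
# K10c — THE TORIC BUDGET SCHEME IS TRANSPORTED EXACTLY BY A BLOW-UP CHART: `Budgeted S → IsChart S Nor L S′ → Budgeted S′`
# (crux `FInjectiveMacaulayfication` stmt-ResolutionOfSingularities-15315, chain w45a; kernel confirmation of the SIGNED-DEFECT rule of `Cruxes/…/Lines/T-disc.md` §0.24 (a),
# `d_{E_Z} = (codim Z − 4) + Σ_{E ⊃ Z} d_E`, on the F-content side; companion of K10/K10b and of `Lines/T_canon_door.lean` v5; seat res-L1-w45a-lead-1 g16)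

[OURS · L1 W4.5a] Support file (`--supports stmt-ResolutionOfSingularities-15315 --as helper`); replaces the role of NO printed item; NOT a statement of any manuscript;
proves nothing of the crux; OURS counted 0. AI-written (AI review is weaker than expert review).

THE STATEMENT (★★ `budgeted_chart`). `Budgeted S` says: for every weight `(w_x; w)` on the five letters some monomial of `P = x³ + b₂x² + b₁x + b₀` has weight
`≤ w_x + Σ_n w_n + Σ_{n∈Exc} d_n w_n`. If `S′` is the `y_L`-chart origin of the blow-up of `S` along `Z = V(x, y_n : n ∈ Nor)` (`IsChart`: `σ_L(bᵢ) = y_L^{3−i}bᵢ′`,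
`Exc′ = Exc ∪ {L}`, `d′_L = (|Nor| + 1 − 4) + Σ_{n∈Exc∩Nor} d_n`, other defects unchanged) and `L ∈ Nor`, then `Budgeted S′`. MECHANISM: pull a weight `(w_x′; w′)` at `x′` back to
`x` by `W_x = w_x′ + w′_L`, `W_n = w′_n + [n ∈ Nor ∖ L]·w′_L` (the chart substitution `x = x′y_L`, `y_n = y_n′y_L`); a monomial `x^i y^e` of `P` becomes the monomial
`x^i y^{τe − (3−i)ε_L}` of `P′` (`coeff_tau_chartMap` + the controlled transform), of `(w_x′;w′)`-weight `= (W-weight) − 3w′_L`; and the budgets satisfy the IDENTITY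
`B(S; W) − 3w′_L = B(S′; w′)` — which is exactly the defect rule for the new divisor (★ `bound_transport`). So the budget hypotheses at later stages of a letter chain are
CONSEQUENCES of the budget at `x₀` (K4) — as the memo asserts; `Reachable` in `T_canon_door` v5 may carry them for free. Exponent bookkeeping only; no named fact.
-/

-- single-problem summit: the doubled namespace component is forced
set_option linter.dupNamespace false

noncomputable section

open MvPolynomial Finsupp
open Summit.ResolutionOfSingularities.ResolutionOfSingularities.Theorems.FInjectiveMacaulayfication.LastCentreDefs
open Summit.ResolutionOfSingularities.ResolutionOfSingularities.Theorems.FInjectiveMacaulayfication.LastCentreAxisOrder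

namespace Summit.ResolutionOfSingularities.ResolutionOfSingularities.Theorems.FInjectiveMacaulayfication.LastCentreBudget

variable {k : Type} [Field k]

/-- The budget bound of a stage at a weight: `w_x + Σ_n w_n + Σ_{n ∈ Exc} d_n w_n`. [OURS · L1 W4.5a · abbreviation used only in this file] -/
def bound (S : Stage k) (wx : ℕ) (w : Letter → ℕ) : ℤ :=
  (wx : ℤ) + ∑ n, (w n : ℤ) + ∑ n ∈ S.Exc, S.d n * w n

/-- `Budgeted` unfolded with `bound`. [plumbing] -/
theorem budgeted_iff (S : Stage k) : Budgeted S ↔ ∀ (wx : ℕ) (w : Letter → ℕ),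
    (3 * (wx : ℤ) ≤ bound S wx w) ∨ ∃ i : Fin 3, ∃ e ∈ (![S.b₀, S.b₁, S.b₂] i).support,
      ((i : ℕ) * (wx : ℤ) + ∑ n, (w n * e n : ℤ)) ≤ bound S wx w := Iff.rfl

/-- The pulled-back weight on the letters at `x`: `W_n = w′_n + [n ∈ Nor ∖ L]·w′_L`. [OURS · L1 W4.5a] -/
def pullW (Nor : Finset Letter) (L : Letter) (w' : Letter → ℕ) : Letter → ℕ :=
  fun n => w' n + if n ∈ Nor.erase L then w' L else 0

/-- ★ THE BUDGET IDENTITY (the defect rule): `B(S; w_x′ + w′_L, W) = B(S′; w_x′, w′) + 3·w′_L`. [OURS · L1 W4.5a] -/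
theorem bound_transport {S S' : Stage k} {Nor : Finset Letter} {L : Letter} (hL : L ∈ Nor) (hch : IsChart S Nor L S')
    (wx' : ℕ) (w' : Letter → ℕ) :
    bound S (wx' + w' L) (pullW Nor L w') = bound S' wx' w' + 3 * (w' L : ℤ) := by
  classical
  obtain ⟨-, -, -, hExc, hd, hdL⟩ := hch
  have hcard : ((Nor.erase L).card : ℤ) = (Nor.card : ℤ) - 1 := by
    rw [Finset.card_erase_of_mem hL]
    have : 1 ≤ Nor.card := Finset.card_pos.mpr ⟨L, hL⟩
    omega
  -- Σ_n W_n = Σ_n w′_n + (|Nor| − 1)·w′_L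
  have h1 : (∑ n, (pullW Nor L w' n : ℤ)) = (∑ n, (w' n : ℤ)) + ((Nor.card : ℤ) - 1) * (w' L : ℤ) := by
    simp only [pullW, Nat.cast_add, Nat.cast_ite, Nat.cast_zero, Finset.sum_add_distrib]
    rw [Finset.sum_ite_mem, Finset.univ_inter, Finset.sum_const, nsmul_eq_mul, hcard]
  -- Σ_{n∈Exc} d_n W_n = Σ_{n∈Exc} d_n w′_n + w′_L · Σ_{n ∈ Exc ∩ Nor.erase L} d_n
  have h2 : (∑ n ∈ S.Exc, S.d n * (pullW Nor L w' n : ℤ)) =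
      (∑ n ∈ S.Exc, S.d n * (w' n : ℤ)) + (w' L : ℤ) * ∑ n ∈ S.Exc ∩ Nor.erase L, S.d n := by
    simp only [pullW, Nat.cast_add, Nat.cast_ite, Nat.cast_zero, mul_add, Finset.sum_add_distrib, mul_ite, mul_zero]
    rw [Finset.sum_ite_mem, Finset.mul_sum]
    congr 1
    exact Finset.sum_congr rfl fun n _ => by ring
  -- Σ_{n ∈ Exc′} d′_n w′_n = d′_L w′_L + Σ_{n ∈ Exc ∖ {L}} d_n w′_n
  have h3 : (∑ n ∈ S'.Exc, S'.d n * (w' n : ℤ)) =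
      S'.d L * (w' L : ℤ) + ∑ n ∈ S.Exc.erase L, S.d n * (w' n : ℤ) := by
    have hins : S'.Exc = insert L (S.Exc.erase L) := by
      rw [hExc]; ext n; simp only [Finset.mem_insert, Finset.mem_erase]; tauto
    rw [hins, Finset.sum_insert (Finset.notMem_erase L S.Exc)]
    congr 1
    exact Finset.sum_congr rfl fun n hn => by rw [hd n (Finset.ne_of_mem_erase hn)]
  -- Σ_{n∈Exc} d_n w′_n = [L ∈ Exc] d_L w′_L + Σ_{n∈Exc∖L} d_n w′_n ;  Σ_{Exc ∩ Nor} d = [L∈Exc] d_L + Σ_{Exc ∩ Nor.erase L} d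
  have h4 : (∑ n ∈ S.Exc, S.d n * (w' n : ℤ)) =
      (if L ∈ S.Exc then S.d L * (w' L : ℤ) else 0) + ∑ n ∈ S.Exc.erase L, S.d n * (w' n : ℤ) := by
    by_cases hLE : L ∈ S.Exc
    · rw [if_pos hLE, ← Finset.add_sum_erase S.Exc _ hLE]
    · rw [if_neg hLE, zero_add, Finset.erase_eq_of_notMem hLE]
  have h5 : (∑ n ∈ S.Exc ∩ Nor, S.d n) = (if L ∈ S.Exc then S.d L else 0) + ∑ n ∈ S.Exc ∩ Nor.erase L, S.d n := by
    have hsplit : S.Exc ∩ Nor = (if L ∈ S.Exc then insert L (S.Exc ∩ Nor.erase L) else S.Exc ∩ Nor.erase L) := by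
      ext n
      by_cases hLE : L ∈ S.Exc
      · rw [if_pos hLE]
        simp only [Finset.mem_inter, Finset.mem_insert, Finset.mem_erase]
        constructor
        · rintro ⟨h1, h2⟩
          by_cases hn : n = L
          · exact Or.inl hn
          · exact Or.inr ⟨h1, hn, h2⟩
        · rintro (rfl | ⟨h1, -, h2⟩)
          · exact ⟨hLE, hL⟩
          · exact ⟨h1, h2⟩
      · rw [if_neg hLE]
        simp only [Finset.mem_inter, Finset.mem_erase]
        constructor
        · rintro ⟨h1, h2⟩
          exact ⟨h1, fun h => hLE (h ▸ h1), h2⟩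
        · rintro ⟨h1, -, h2⟩
          exact ⟨h1, h2⟩
    by_cases hLE : L ∈ S.Exc
    · rw [hsplit, if_pos hLE, if_pos hLE, Finset.sum_insert]
      simp [Finset.mem_inter, Finset.mem_erase]
    · rw [hsplit, if_neg hLE, if_neg hLE, zero_add]
  simp only [bound]
  rw [h1, h2, h3, h4, hdL, h5]
  push_cast
  split_ifs <;> ring

/-- The weight of the transformed exponent: `Σ_n w′_n (τe)_n = Σ_n W_n e_n`. [plumbing] -/
theorem weight_tau (Nor : Finset Letter) (L : Letter) (w' : Letter → ℕ) (e : Expo) :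
    (∑ n, (w' n * tau Nor L e n : ℤ)) = ∑ n, (pullW Nor L w' n * e n : ℤ) := by
  classical
  have hτ : ∀ n, (tau Nor L e n : ℤ) = (e n : ℤ) + if n = L then (norDeg (Nor.erase L) e : ℤ) else 0 := by
    intro n
    rw [tau_apply]
    simp only [Finsupp.coe_add, Pi.add_apply, Finsupp.single_apply, Nat.cast_add]
    by_cases h : L = n
    · subst h; simp
    · rw [if_neg h, if_neg (Ne.symm h)]; simp
  simp only [hτ, pullW, Nat.cast_add, Nat.cast_ite, Nat.cast_zero, mul_add, add_mul, Finset.sum_add_distrib, mul_ite, mul_zero,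
    ite_mul, zero_mul]
  congr 1
  rw [Finset.sum_ite_eq' Finset.univ L, if_pos (Finset.mem_univ _), norDeg, Nat.cast_sum, Finset.mul_sum, Finset.sum_ite_mem,
    Finset.univ_inter]

/-- ★★ THE TORIC BUDGET SCHEME IS TRANSPORTED BY THE CHART: `Budgeted S → Budgeted S′` along `IsChart S Nor L S′` with `L ∈ Nor`. Consequently the budget
hypotheses at all stages of a letter chain follow from the budget at the initial stage (F-purity at `x₀`, K4). [OURS · L1 W4.5a] -/
theorem budgeted_chart {S S' : Stage k} {Nor : Finset Letter} {L : Letter} (hL : L ∈ Nor) (hch : IsChart S Nor L S')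
    (hS : Budgeted S) : Budgeted S' := by
  classical
  intro wx' w'
  have hB := bound_transport hL hch wx' w'
  rcases hS (wx' + w' L) (pullW Nor L w') with hx | ⟨i, e, he, hw⟩
  · left
    change 3 * (wx' : ℤ) ≤ bound S' wx' w'
    change 3 * ((wx' + w' L : ℕ) : ℤ) ≤ bound S (wx' + w' L) (pullW Nor L w') at hx
    push_cast at hx
    linarith
  · right
    change ((i : ℕ) * ((wx' + w' L : ℕ) : ℤ) + ∑ n, (pullW Nor L w' n * e n : ℤ)) ≤ bound S (wx' + w' L) (pullW Nor L w') at hw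
    -- the controlled transform: σ_L(bᵢ) = y_L^{3−i} · bᵢ′
    have hct : chartMap Nor L ((![S.b₀, S.b₁, S.b₂] : Fin 3 → YPoly k) i) =
        X L ^ (3 - (i : ℕ)) * (![S'.b₀, S'.b₁, S'.b₂] : Fin 3 → YPoly k) i := by
      obtain ⟨h2, h1, h0, -⟩ := hch
      fin_cases i
      · simpa using h0
      · simpa using h1
      · simpa [pow_one] using h2
    -- the monomial τe of σ_L(bᵢ) is the monomial τe − (3−i)ε_L of bᵢ′
    have hc : coeff (tau Nor L e) (monomial (Finsupp.single L (3 - (i : ℕ))) (1 : k) * (![S'.b₀, S'.b₁, S'.b₂] : Fin 3 → YPoly k) i) ≠ 0 := by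
      rw [← X_pow_eq_monomial, ← hct, coeff_tau_chartMap]
      exact MvPolynomial.mem_support_iff.mp he
    obtain ⟨hle, hc2⟩ := le_and_coeff_of_coeff_monomial_mul hc
    refine ⟨i, tau Nor L e - Finsupp.single L (3 - (i : ℕ)), MvPolynomial.mem_support_iff.mpr hc2, ?_⟩
    change ((i : ℕ) * (wx' : ℤ) + ∑ n, (w' n * ((tau Nor L e - Finsupp.single L (3 - (i : ℕ))) n : ℕ) : ℤ)) ≤ bound S' wx' w'
    -- weight of the transformed monomial = pulled-back weight − 3 w′_L
    have hsub : ∀ n, (((tau Nor L e - Finsupp.single L (3 - (i : ℕ))) n : ℕ) : ℤ) =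
        (tau Nor L e n : ℤ) - if n = L then ((3 - (i : ℕ) : ℕ) : ℤ) else 0 := by
      intro n
      have hn : Finsupp.single L (3 - (i : ℕ)) n ≤ tau Nor L e n := hle n
      simp only [Finsupp.coe_tsub, Pi.sub_apply]
      rw [Nat.cast_sub hn]
      simp only [Finsupp.single_apply]
      by_cases h : L = n
      · subst h; simp
      · rw [if_neg h, if_neg (Ne.symm h)]; simp
    have hi : ((i : ℕ) : ℤ) ≤ 2 := by have := i.isLt; omega
    simp only [hsub, mul_sub, Finset.sum_sub_distrib, mul_ite, mul_zero, Finset.sum_ite_eq' Finset.univ L,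
      if_pos (Finset.mem_univ _)]
    rw [weight_tau]
    have h3i : (((3 - (i : ℕ) : ℕ) : ℤ)) = 3 - ((i : ℕ) : ℤ) := by
      rw [Nat.cast_sub (by have := i.isLt; omega)]; simp
    rw [h3i]
    push_cast at hw
    nlinarith [hw, hB, hi, Nat.cast_nonneg (α := ℤ) (w' L), Nat.cast_nonneg (α := ℤ) (i : ℕ)]

end Summit.ResolutionOfSingularities.ResolutionOfSingularities.Theorems.FInjectiveMacaulayfication.LastCentreBudget

end
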